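import Summits.BirchSwinnertonDyer.BirchSwinnertonDyer.Theorems.KatoDescentTamePotSupersingularTameUpperOpenRowCertificates
import Literature.NumberTheory.EllipticCurves.FineSelmerRankEqualityNonsplitCartanFive
import HarnessLib

/-!
# Route `KatoDescentTamePotSupersingular` (rung K8, sub-rung B4 (t′), cell `bsd-potss`): U₀ at a `5Nn` row FROM THE RANK EQUALITY
# `rank_5 Cl(ℚ(P)) = rank_5 Cl(ℚ(x(P)))` — NO `μ`-HYPOTHESIS — and the row `396900b1` @ 5

Seat `bsd-potss-k8t-c4` g25; `--supports stmt-BirchSwinnertonDyer-19982 --as helper`. THEOREMS ONLY (no definition, no named fact, no `sorry`);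
nothing booked; (A), Conjecture A and BSD are proved for NO curve here; items 19202 / 19982 stay OPEN at class level (open inputs: zeta crux 24439,
lower half of 19984).

§3 `missingUpperBoundAt_five_tame_of_nonsplitCartanBasis_of_rankEq` — U₀ `MissingUpperBoundAt E 5` at a rank-`0` (t′) row with mod-5 image in `C_ns⁺(5)`
modulo `hKatoA hGZK hmod`, from the basis data, the rank equality `#Cl(ℚ(P))[5] = #Cl(ℚ(x(P)))[5]` and `σ̄_x¹² ∈ I(𝔮|5)`: the Literature road
`CoatesSujatha2005.RankEqualityRoad.conjA_five_of_nonsplitCartanBasis_of_rankEq` (statement (A), fact-free) ∘ `CartanMuRoadDoorsTprimeFive.missingUpperBoundAt_tame_of_conjA`.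
Compare the tree's `…_of_nonsplitCartanBasis_of_mu` (SEVEN classical `μ`-hypotheses) and the seat's `TameRankEqRecords.missingUpperBoundAt_g396900b1_5_of_mu_rankEq`
(six): here NONE.
§4 `missingUpperBoundAt_g396900b1_5_of_rankEq` — the row `396900b1` @ 5 (the U₀-ns row of KT whose `ℚ(P)`-leaf `μ`-hypothesis was numerically out of
reach): U₀ from `hKatoA hGZK hmod` + Cremona's `r_an = 0` + the basis data + `hrank` (numerically `5 = 5`: `h(ℚ(x(P))) = 30` certified, `h(ℚ(P)) = 60`
under GRH; kit j332102) + `hcI` (`e(𝔮|5) = 8` for the three primes above 5; kit j332102).  KERNEL: `E[5]` irreducible, `Addv`, `SubTprime` (tree,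
`TameConjAFiveRecords`), `5 ∤ #Gal(ℚ(E[5])/ℚ)`, `σ̄_x¹²` central (Literature road).  CONDITIONAL; per row; nothing booked.

References: [Kato2004Asterisque] Thm. 14.5 (3); [CoatesSujatha2005] Thm. 3.4; [Iwasawa1956]; [Serre1972] §2.2; [Cremona2006] Table 1.
-/

set_option autoImplicit false
set_option linter.dupNamespace false

noncomputable section

open scoped Classical NumberField Matrix
open WeierstrassCurve Field IntermediateField
  Literature.NumberTheory.EllipticCurves Literature.NumberTheory.EllipticCurves.Rank1Residual
  Literature.NumberTheory.EllipticCurves.Rank1Residual.Typed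
  Literature.NumberTheory.GaloisRepresentations Literature.NumberTheory.SerreUniformity
  Literature.NumberTheory.IwasawaTheory
  Literature.NumberTheory.EllipticCurves.CoatesSujatha2005.RankEqualityRoad
  Summit.BirchSwinnertonDyer.Rank1Residual Summit.BirchSwinnertonDyer.Rank1Residual.Additive
  Summit.BirchSwinnertonDyer.BirchSwinnertonDyer.Theorems

namespace Summit.BirchSwinnertonDyer.BirchSwinnertonDyer.Theorems.TameRankEqRecords

/-! ### §3 U₀ at a rank-`0` (t′) `5Nn` row from the rank equality (modulo `hKatoA hGZK hmod`) -/

/-- **U₀ `MissingUpperBoundAt E 5` at a rank-`0` (t′) row with image in `C_ns⁺(5)` FROM THE RANK EQUALITY** — the named facts `hKatoA hGZK hmod`,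
Cremona's `r_an = 0`, `Addv E 5`, `SubTprime E 5`, `E[5]` irreducible, the basis data, `#Cl(ℚ(P))[5] = #Cl(ℚ(x(P)))[5]` and `σ̄_x¹² ∈ I(𝔮|5)`; NO
`μ`-hypothesis (compare `CartanMuRoadDoorsTprimeFive.missingUpperBoundAt_five_tame_of_nonsplitCartanBasis_of_mu`: seven of them).  §2 ∘
`CartanMuRoadDoorsTprimeFive.missingUpperBoundAt_tame_of_conjA`.  CONDITIONAL; nothing booked; BSD for no curve.
[cite: Kato2004Asterisque, Thm. 14.5 (3) (p. 236)] [cite: CoatesSujatha2005, §3 Thm. 3.4] [cite: Iwasawa1956, §§3–5] [cite: Serre1972, §2.2] -/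
theorem missingUpperBoundAt_five_tame_of_nonsplitCartanBasis_of_rankEq (W : WeierstrassCurve ℚ) [W.IsElliptic] [W.IsGloballyMinimal]
    (hKatoA : Kato2004.rankZero_padicValNat_sha_add_padicValNat_tamagawa_le_of_additive_potGood_of_irreducible_of_fineSelmerDual_fg)
    (hGZK : rank_eq_analyticRank_of_analyticRank_le_one) (hmod : hasEntireLFunction_rat)
    (hr : W.analyticRank = 0) (hadd : haveI : Fact (Nat.Prime 5) := ⟨by norm_num⟩; Addv W 5)
    (hT : haveI : Fact (Nat.Prime 5) := ⟨by norm_num⟩; SubTprime W 5)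
    (hirr : haveI : Fact (Nat.Prime 5) := ⟨by norm_num⟩; W.HasIrreducibleModPGaloisRep 5)
    (e : W.geomTorsion (5 : ℕ) ≃+ (Fin 2 → ZMod 5)) {ε : ZMod 5} (hε : ¬ IsSquare ε)
    (he : ∀ σ : absoluteGaloisGroup ℚ, ∃ M ∈ nonsplitCartanNormalizer ε, ∀ P : W.geomTorsion (5 : ℕ), e (σ • P) = M *ᵥ e P)
    (σx σs : absoluteGaloisGroup ℚ) (hσx : ∀ P : W.geomTorsion (5 : ℕ), e (σx • P) = !![1, ε * (4 - ε); 4 - ε, 1] *ᵥ e P)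
    (hσs : ∀ P : W.geomTorsion (5 : ℕ), e (σs • P) = !![1, 0; 0, 4] *ᵥ e P)
    (hrank : Nat.card {d : ClassGroup (𝓞 ↥(fixedField (Subgroup.zpowers (absRestrictNormalHom (W.divisionField 5) σs)))) // d ^ 5 = 1} =
      Nat.card {d : ClassGroup (𝓞 ↥(fixedField (Subgroup.zpowers (absRestrictNormalHom (W.divisionField 5) σx ^ 12) ⊔
        Subgroup.zpowers (absRestrictNormalHom (W.divisionField 5) σs)))) // d ^ 5 = 1})
    (hcI : ∀ (𝔮 : Ideal (𝓞 ↥(W.divisionField 5))) [𝔮.IsMaximal], ((5 : ℕ) : 𝓞 ↥(W.divisionField 5)) ∈ 𝔮 →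
      absRestrictNormalHom (W.divisionField 5) σx ^ 12 ∈ 𝔮.inertia _) :
    haveI : Fact (Nat.Prime 5) := ⟨by norm_num⟩
    MissingUpperBoundAt W 5 := by
  haveI : Fact (Nat.Prime 5) := ⟨by norm_num⟩
  exact CartanMuRoadDoorsTprimeFive.missingUpperBoundAt_tame_of_conjA W hKatoA hGZK hmod 5 hr (by decide) hadd hT hirr
    (conjA_five_of_nonsplitCartanBasis_of_rankEq W e hε he σx σs hσx hσs hrank hcI)

/-! ### §4 The row `396900b1` @ 5 -/

/-- **CONDITIONAL U₀ for `396900b1` @ 5 FROM THE RANK EQUALITY — no `μ`-hypothesis.**  `ord₅ #Ш(E) ≤ ord₅ #Ш_an(E)` (`MissingUpperBoundAt E 5`) for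
`E = 396900b1 = [0, 0, 0, −73959375, 244814963750]` (`N = 2²·3⁴·5²·7²`, Kodaira IV* at 5, (t′), mod-5 image `C_ns⁺(5)`), from: the named facts
`hKatoA hGZK hmod`; Cremona's `r_an = 0` (`hr`); the `C_ns⁺(ε)` basis data (`e hε he σx σs hσx hσs`); the rank equality `#Cl(ℚ(P))[5] = #Cl(ℚ(x(P)))[5]`
(`hrank`; numerically `5 = 5`: `h(ℚ(x(P))) = 30` certified, `h(ℚ(P)) = 60` under GRH, kit j332102); and `σ̄_x¹² ∈ I(𝔮)` for the primes `𝔮 ∋ 5` of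
`ℚ(E[5])` (`hcI`; `e(𝔮|5) = 8`, kit j332102).  KERNEL: `E[5]` irreducible, `Addv`, `SubTprime` (tree, `TameConjAFiveRecords`), `5 ∤ #Gal(ℚ(E[5])/ℚ)`,
`σ̄_x¹²` central.  Per row; CONDITIONAL; nothing booked; BSD is not proved by this. [cite: Kato2004Asterisque, Thm. 14.5 (3) (p. 236)]
[cite: CoatesSujatha2005, §3 Thm. 3.4] [cite: Iwasawa1956, §§3–5] [cite: Cremona2006, Table 1 (Cremona label 396900b1)] -/
theorem missingUpperBoundAt_g396900b1_5_of_rankEq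
    (hKatoA : Kato2004.rankZero_padicValNat_sha_add_padicValNat_tamagawa_le_of_additive_potGood_of_irreducible_of_fineSelmerDual_fg)
    (hGZK : rank_eq_analyticRank_of_analyticRank_le_one) (hmod : hasEntireLFunction_rat)
    {W : WeierstrassCurve ℚ} [W.IsElliptic] [W.IsGloballyMinimal] (hWeq : W = (⟨0, 0, 0, (-73959375), 244814963750⟩ : WeierstrassCurve ℚ))
    (hr : W.analyticRank = 0)
    (e : W.geomTorsion (5 : ℕ) ≃+ (Fin 2 → ZMod 5)) {ε : ZMod 5} (hε : ¬ IsSquare ε)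
    (he : ∀ σ : absoluteGaloisGroup ℚ, ∃ M ∈ nonsplitCartanNormalizer ε, ∀ P : W.geomTorsion (5 : ℕ), e (σ • P) = M *ᵥ e P)
    (σx σs : absoluteGaloisGroup ℚ) (hσx : ∀ P : W.geomTorsion (5 : ℕ), e (σx • P) = !![1, ε * (4 - ε); 4 - ε, 1] *ᵥ e P)
    (hσs : ∀ P : W.geomTorsion (5 : ℕ), e (σs • P) = !![1, 0; 0, 4] *ᵥ e P)
    (hrank : Nat.card {d : ClassGroup (𝓞 ↥(fixedField (Subgroup.zpowers (absRestrictNormalHom (W.divisionField 5) σs)))) // d ^ 5 = 1} =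
      Nat.card {d : ClassGroup (𝓞 ↥(fixedField (Subgroup.zpowers (absRestrictNormalHom (W.divisionField 5) σx ^ 12) ⊔
        Subgroup.zpowers (absRestrictNormalHom (W.divisionField 5) σs)))) // d ^ 5 = 1})
    (hcI : ∀ (𝔮 : Ideal (𝓞 ↥(W.divisionField 5))) [𝔮.IsMaximal], ((5 : ℕ) : 𝓞 ↥(W.divisionField 5)) ∈ 𝔮 →
      absRestrictNormalHom (W.divisionField 5) σx ^ 12 ∈ 𝔮.inertia _) :
    MissingUpperBoundAt W 5 := by
  subst hWeq
  exact missingUpperBoundAt_five_tame_of_nonsplitCartanBasis_of_rankEq _ hKatoA hGZK hmod hr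
    TameConjAFiveRecords.addv_g396900b1_5 TameConjAFiveRecords.subTprime_g396900b1_5 TameConjAFiveRecords.irr_g396900b1_5
    e hε he σx σs hσx hσs hrank hcI

end Summit.BirchSwinnertonDyer.BirchSwinnertonDyer.Theorems.TameRankEqRecords

end
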